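import Summits.NavierStokesRegularity.NavierStokesRegularity.Theorems.PalasekTowerBreakdownEpisodeBaseSuperposedFreeRun
import Summits.NavierStokesRegularity.FluidComputer.PalasekTowerGermHostPotentialAmplifier

/-!
# `EpisodeBase` (crux stmt-NavierStokesRegularity-19179) from ONE free run of a vector-potential amplifier
# `curl A` and ONE tame free run of the numeric tiny carrier — BY NAME, every side condition closed-form

Cell `ns-blowup`, seat `ns-blowup-ecbridge-3` (g7; D-0074 GROUP C «BRIDGE SUPPORT», lineage `host_preparation`).
Route `PalasekTowerBreakdown`, crux `EpisodeBase`, line `slot` v5. The typist-facing form of the dynamic companion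
rule (`palasekTowerBreakdown_episodeBase_of_amplifier_freeRun`, this seat): the amplifier is handed over as a smooth
VECTOR POTENTIAL `A` with `tsupport A ⊆ B̄(0, R)` and Jacobian bound `‖DA‖ ≤ L`, `4L < Y₀` — then `W = curl A`
is smooth, divergence free, supported in `B̄(0, R)` and slower than `Y₀` by the tree's potential-amplifier
lemmas (`contDiff_curl_top`, `isDivFree_curl`, `tsupport_curl_subset`, `norm_curl_le_of_fderiv_le`,
GermHostPotentialAmplifier), so the only analytic obligations left are the two FREE runs. LABEL: E–C typing
(KERNEL: theorems only; `--supports` stmt-NavierStokesRegularity-19179). WHAT THIS IS NOT: not Navier–Stokes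
evidence — no free run meeting the letter is exhibited; nothing about `RungG 1` or blow-up is asserted.

* `palasekTowerBreakdown_episodeBase_of_curl_amplifier_freeRun` — `0 < a ≤ 11/648`, `A ∈ C^∞`,
  `tsupport A ⊆ B̄(0, R)`, `‖DA‖ ≤ L`, `4L < Y₀`; ONE classical finite-energy free run of `strictTinyProfile a` on
  `[1, Host.τfirst]` below `(5/3)Y₁ − η`; ONE classical finite-energy free run of `curl A` on `[1, Host.τfirst]`
  below `(5/3)Y₁ − η` meeting the three level-`1` faces with margin `η` inside `‖x‖ ≤ R` ⟹ `EpisodeBase`.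

References: S. Palasek, arXiv:2605.13827 §4 [cite: Palasek2026ElementaryModel, §4]; A. J. Majda, A. L. Bertozzi,
*Vorticity and Incompressible Flow* (2002), §1.1 (1.11) [cite: MajdaBertozziCUP2002, §1.1 (1.11)].
-/

noncomputable section

-- `Summit.<Summit>.<Problem>` is the tree's mandated summit-side namespace (CONVENTIONS §2); for this
-- single-conjunct summit the two coincide, so the duplicate is deliberate.
set_option linter.dupNamespace false

namespace Summit.NavierStokesRegularity.NavierStokesRegularity.Theorems

open Set Function MeasureTheory Metric
open scoped ENNReal ContDiff
open Summit.NavierStokesRegularity.NavierStokesRegularity.Theses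
open Summit.NavierStokesRegularity.FluidComputer.PalasekTowerClayBridge
open Summit.NavierStokesRegularity.FluidComputer.PalasekTowerClayBridge.Germ
open Literature.Analysis.FluidPDE

/-- **`EpisodeBase` FROM A VECTOR-POTENTIAL AMPLIFIER RUN AND ONE TAME TINY-CARRIER RUN.** Let
`0 < a ≤ 11/648`, `A` smooth with `tsupport A ⊆ B̄(0, R)` (`R ≥ 0`), `‖DA(x)‖ ≤ L` for all `x` and `4L < Y₀`.
Given ONE classical finite-energy free run (`ν = 1`) of `strictTinyProfile a` on `[1, Host.τfirst]` below
`(5/3) Y₁ − η` and ONE classical finite-energy free run of `curl A` on `[1, Host.τfirst]` below `(5/3) Y₁ − η`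
showing at `Host.τfirst`, inside `‖x‖ ≤ R`, speed `≥ Y₁ + η`, gradient `≥ A₁ + η` and an `N₁`-core loop of
circulation `≥ N₁^{β−2} + η` (`η > 0`), `EpisodeBase` holds. [cite: Palasek2026ElementaryModel, §4]
[cite: MajdaBertozziCUP2002, §1.1 (1.11)] -/
theorem palasekTowerBreakdown_episodeBase_of_curl_amplifier_freeRun {a : ℝ} (ha : 0 < a) (ha' : a ≤ 11 / 648)
    {A : EuclideanSpace ℝ (Fin 3) → EuclideanSpace ℝ (Fin 3)} {R L : ℝ}
    (hA : ContDiff ℝ ∞ A) (hAsupp : tsupport A ⊆ closedBall 0 R) (hR : 0 ≤ R)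
    (hL : ∀ x, ‖fderiv ℝ A x‖ ≤ L) (h4L : 4 * L < TowerRates.wide.Y 0)
    {v₁ : ℝ → EuclideanSpace ℝ (Fin 3) → EuclideanSpace ℝ (Fin 3)} {q₁ : ℝ → EuclideanSpace ℝ (Fin 3) → ℝ}
    (hv₁ : IsClassicalNSSolutionOn (Icc 1 Host.τfirst) 1 0 v₁ q₁) (hv₁1 : v₁ 1 = strictTinyProfile a)
    (hv₁E : ∃ C : ℝ≥0∞, C < ⊤ ∧ ∀ t ∈ Icc (1 : ℝ) Host.τfirst, ∫⁻ x, ‖v₁ t x‖ₑ ^ 2 ≤ C)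
    {v₂ : ℝ → EuclideanSpace ℝ (Fin 3) → EuclideanSpace ℝ (Fin 3)} {q₂ : ℝ → EuclideanSpace ℝ (Fin 3) → ℝ}
    (hv₂ : IsClassicalNSSolutionOn (Icc 1 Host.τfirst) 1 0 v₂ q₂) (hv₂1 : v₂ 1 = curl A)
    (hv₂E : ∃ C : ℝ≥0∞, C < ⊤ ∧ ∀ t ∈ Icc (1 : ℝ) Host.τfirst, ∫⁻ x, ‖v₂ t x‖ₑ ^ 2 ≤ C)
    {η : ℝ} (hη : 0 < η)
    (hcap₁ : ∀ t ∈ Icc (1 : ℝ) Host.τfirst, ∀ x, ‖v₁ t x‖ ≤ 5 / 3 * TowerRates.wide.Y 1 - η)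
    (hcap₂ : ∀ t ∈ Icc (1 : ℝ) Host.τfirst, ∀ x, ‖v₂ t x‖ ≤ 5 / 3 * TowerRates.wide.Y 1 - η)
    (hspeed : ∃ x, ‖x‖ ≤ R ∧ TowerRates.wide.Y 1 + η ≤ ‖v₂ Host.τfirst x‖)
    (hstrain : ∃ x, ‖x‖ ≤ R ∧ TowerRates.wide.A 1 + η ≤ ‖fderiv ℝ (v₂ Host.τfirst) x‖)
    (hcore : ∃ (x : EuclideanSpace ℝ (Fin 3)) (γ : ℝ → EuclideanSpace ℝ (Fin 3)),
      ‖x‖ ≤ R ∧ ContDiff ℝ 1 γ ∧ γ 0 = γ 1 ∧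
      (∀ s ∈ Icc (0 : ℝ) 1, γ s ∈ closedBall x (1 / TowerRates.wide.N 1)) ∧
      (∀ s ∈ Icc (0 : ℝ) 1, ‖deriv γ s‖ ≤ 8 * Real.pi / TowerRates.wide.N 1) ∧
      TowerRates.wide.N 1 ^ (TowerRates.wide.β - 2) + η ≤ circulation (v₂ Host.τfirst) γ) :
    PalasekTowerBreakdown.EpisodeBase :=
  palasekTowerBreakdown_episodeBase_of_amplifier_freeRun ha ha' (contDiff_curl_top hA) (isDivFree_curl hA)
    (tsupport_curl_subset hAsupp) (fun x => (norm_curl_le_of_fderiv_le hL x).trans_lt h4L) hR hv₁ hv₁1 hv₁E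
    hv₂ hv₂1 hv₂E hη hcap₁ hcap₂ hspeed hstrain hcore

end Summit.NavierStokesRegularity.NavierStokesRegularity.Theorems

end
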